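import Summits.AnomalousDissipation.AnomalousDissipation.Theorems.SolenoidalFractalHomogenisationLagrangianStepSidebandResponseUnique
import Literature.Analysis.FunctionSpaces.TorusTrigPoly
import HarnessLib

/-!
# K1L_D `LagrangianRenormalisationStepDesign` (stmt-AnomalousDissipation-27980), `stub_cellLawV0_IS` V0 — brick T2 (structure, part 2a):
# the REAL STRUCTURE of the truncated `ξ = 0` sideband system — fibre lemmas (conjugation / `k ↦ −k` symmetries of the symbol and the Leray projection),
# symmetry of the box, parity of the link coefficient, and the conjugate flip read through `coordL` (helper; `--supports stmt-AnomalousDissipation-27980`)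

Summits-side helper file of route `SolenoidalFractalHomogenisation` (prover seat `ad-k1l-cellLawV-w1` g5; tenure D26-3 proviso P3 «`Re` + a conjugation-symmetry
lemma»).  Everything proved; no definitions, no named facts, no sorry.  The cell problem is REAL; on the lattice this is the involution
`(J y)_z = −conj(y_{−z})` of `Space R` (the sign absorbs the purely imaginary link prefactor `2πi`), under which
`gen (J y) = J (gen y)`, `source (conj v) = J (source v)`, `feedback (J y) = conj (feedback y)`.

* fibre lemmas: `conjVec_symbT`, `symbT_neg_wave`, `kdot_conjVec`, `kdot_neg_wave`, `conjVec_transversalProj`, `transversalProj_neg_wave`;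
* lattice: `neg_mem_box`, `linkCoeff_neg_wave` (`linkCoeffⱼ(−z) = −linkCoeffⱼ(z)`), `conj_linkCoeff_neg_wave`, `coordL_conjFlip`
  (`coordL w (J y) = −conj (coordL (−w) y)`).
Part 2b (`gen ∘ J = J ∘ gen`, `source (conj v) = J (source v)`, `feedback ∘ J = conj ∘ feedback`; then uniqueness ⇒ `response (conj v) = J (response v)` ⇒ the
matrices `M_{jj'}` have REAL entries, so `psiStar`'s `Re` is exact) builds on these.
NOT a proof of any registered stub, of the crux, or of anomalous dissipation; rung F-D1.A0 infrastructure.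
-/

set_option linter.dupNamespace false

noncomputable section

namespace Summit.AnomalousDissipation.AnomalousDissipation.Theorems.SolenoidalFractalHomogenisation.LagrangianStep.Sideband

open Set MeasureTheory Complex UnitAddTorus Filter Topology
open scoped InnerProductSpace ComplexConjugate
open Literature.Analysis Literature.Analysis.FunctionSpaces Literature.Analysis.FunctionSpaces.Torus
open Literature.Analysis.FluidPDE Literature.Analysis.FluidPDE.Torus Literature.Analysis.FluidPDE.LatticeShear
open Summit.AnomalousDissipation.AnomalousDissipation.Theorems.SolenoidalFractalHomogenisation.LagrangianStep.CellChain (linkCoeff conj_linkCoeff)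

variable {k₀ : ℕ}

/-! ## §1 Fibre lemmas on `ℂ³` -/

/-- The symbol matrix has real entries: `conj (T_𝔸(k) z) = T_𝔸(k) (conj z)`. [cite: Frisch1995Turbulence, §9.6.3 eq. (9.57) p. 233] -/
theorem conjVec_symbT (𝔸 : Torus.Visc4 (Fin 3)) (k : Fin 3 → ℤ) (z : EuclideanSpace ℂ (Fin 3)) :
    EuclideanSpace.conjVec (Torus.symbT 𝔸 k z) = Torus.symbT 𝔸 k (EuclideanSpace.conjVec z) := by
  ext i
  simp [Torus.symbT_apply]

/-- The symbol matrix is even in the wave vector: `T_𝔸(−k) = T_𝔸(k)`. [cite: Frisch1995Turbulence, §9.6.3 eq. (9.57) p. 233] -/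
theorem symbT_neg_wave (𝔸 : Torus.Visc4 (Fin 3)) (k : Fin 3 → ℤ) (z : EuclideanSpace ℂ (Fin 3)) :
    Torus.symbT 𝔸 (-k) z = Torus.symbT 𝔸 k z := by
  ext i
  simp only [Torus.symbT_apply, Pi.neg_apply, Int.cast_neg, mul_neg, neg_mul, neg_neg]

/-- `k · conj z = conj (k · z)`. [cite: Temam1984, Ch. III §1.1] -/
theorem kdot_conjVec (k : Fin 3 → ℤ) (z : EuclideanSpace ℂ (Fin 3)) : kdot k (EuclideanSpace.conjVec z) = conj (kdot k z) := by
  simp [kdot_apply, map_sum, map_mul]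

/-- `(−k) · z = −(k · z)`. [cite: Temam1984, Ch. III §1.1] -/
theorem kdot_neg_wave (k : Fin 3 → ℤ) (z : EuclideanSpace ℂ (Fin 3)) : kdot (-k) z = -kdot k z := by
  simp [kdot_apply, Finset.sum_neg_distrib]

/-- The Leray projection has real entries: `conj (P_k z) = P_k (conj z)`. [cite: Temam1984, Ch. III §1.1] -/
theorem conjVec_transversalProj (k : Fin 3 → ℤ) (z : EuclideanSpace ℂ (Fin 3)) :
    EuclideanSpace.conjVec (transversalProj k z) = transversalProj k (EuclideanSpace.conjVec z) := by
  have hw : EuclideanSpace.conjVec (waveVecC k : EuclideanSpace ℂ (Fin 3)) = waveVecC k := by ext i; simp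
  rw [transversalProj_apply, transversalProj_apply, EuclideanSpace.conjVec_sub, EuclideanSpace.conjVec_smul, hw, kdot_conjVec, map_mul, map_inv₀, Complex.conj_ofReal]

/-- The Leray projection is even in the wave vector: `P_{−k} = P_k`. [cite: Temam1984, Ch. III §1.1] -/
theorem transversalProj_neg_wave (k : Fin 3 → ℤ) (z : EuclideanSpace ℂ (Fin 3)) : transversalProj (-k) z = transversalProj k z := by
  have hw : (waveVecC (-k) : EuclideanSpace ℂ (Fin 3)) = -waveVecC k := by ext i; simp
  rw [transversalProj_apply, transversalProj_apply, kdot_neg_wave, hw, freqNormSq_neg, mul_neg, neg_smul, smul_neg, neg_neg]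

/-! ## §2 Lattice lemmas -/

/-- The box is symmetric: `z ∈ box R → −z ∈ box R`. [cite: MajdaKramer1999, §2.2.1.3] -/
theorem neg_mem_box {R : ℕ} {z : Fin 3 → ℤ} (h : z ∈ box R) : -z ∈ box R := by
  rw [mem_box] at h ⊢
  refine ⟨fun i => ?_, neg_ne_zero.2 h.2⟩
  have := h.1 i
  simp only [Pi.neg_apply]
  omega

/-- The link coefficient is odd in the wave vector: `linkCoeffⱼ(−z) = −linkCoeffⱼ(z)`. [cite: MeshalkinSinai1961, pp. 1700–1705] -/
theorem linkCoeff_neg_wave (W₁ : LatticeWord k₀) (n : ℕ) (z : Fin 3 → ℤ) (j : Fin k₀) (t : ℝ) :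
    linkCoeff W₁ n (-z) j t = -linkCoeff W₁ n z j t := by
  rw [linkCoeff_eq, linkCoeff_eq]
  simp only [Pi.neg_apply, Int.cast_neg, mul_neg, Finset.sum_neg_distrib, neg_mul]

/-- `conj (linkCoeffⱼ(−z)) = linkCoeffⱼ(z)` (odd and purely imaginary). [cite: MeshalkinSinai1961, pp. 1700–1705] -/
theorem conj_linkCoeff_neg_wave (W₁ : LatticeWord k₀) (n : ℕ) (z : Fin 3 → ℤ) (j : Fin k₀) (t : ℝ) :
    conj (linkCoeff W₁ n (-z) j t) = linkCoeff W₁ n z j t := by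
  rw [linkCoeff_neg_wave, map_neg, conj_linkCoeff, neg_neg]

/-- Reading an amplitude of the conjugate-flipped state: `coordL w (J y) = −conj (coordL (−w) y)`, `(J y)_z = −conj(y_{−z})`. [cite: MajdaKramer1999, §2.2.1.3] -/
theorem coordL_conjFlip {R : ℕ} (y : Space R) (w : Fin 3 → ℤ) :
    coordL R w (WithLp.toLp 2 fun z : box R => -EuclideanSpace.conjVec (y ⟨-z.1, neg_mem_box z.2⟩)) = -EuclideanSpace.conjVec (coordL R (-w) y) := by
  by_cases hw : w ∈ box R
  · have hw' : -w ∈ box R := neg_mem_box hw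
    rw [coordL_apply_of_mem hw, coordL_apply_of_mem hw']
  · have hw' : -w ∉ box R := fun h => hw (by simpa using neg_mem_box h)
    rw [coordL_apply_of_not_mem hw, coordL_apply_of_not_mem hw', EuclideanSpace.conjVec_zero, neg_zero]

end Summit.AnomalousDissipation.AnomalousDissipation.Theorems.SolenoidalFractalHomogenisation.LagrangianStep.Sideband

end
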